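import Summits.CriticalPhenomena.PercolationContinuityZ3.Theses.PercNearOneGluing
import Literature.Probability.Percolation.PercolationProofs
import Literature.Probability.Percolation.ConditionalPositiveAssociationProofs
import Literature.Probability.Percolation.TwoClusterConditionalAssociationProofs
import Summits.CriticalPhenomena.PercolationContinuityZ3.Theorems.PercNearOneGluingAdditiveGluingGoodTwoRelays

/-! TTRL-lite variant V2096 of stmt-CriticalPhenomena-4576

(`stub_goodStep`, move `specialise+small_case`: `n := 8` and `A.card ≤ 2`).  With at most two
relays the additive gluing good step is the plain union bound: every bad event lies inside
`{a ↮ b}` for the unique relay `a ≠ b` (or is empty when `A = {b}`): the `sel W = b` pocket terms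
vanish (`b ↔ b in Wᶜ` for `b ∉ W`), the `sel W = a` pocket terms decouple by the pocket Markov
property into `μ(C(o) = W, a ↮ b)`, and `{o ↔ A, o ↮ b} ⊆ {a ↮ b}`; altogether `≤ μ(a ↮ b) ≤ t`.
This is exactly the proved two-relay case `stub_goodStepTwoRelays_k41` (`A.card ≤ 3`, any `n`);
neither the non-degeneracy hypothesis nor the induction hypothesis is needed.
No new definitions, no named facts. -/

namespace Summit.CriticalPhenomena.PercolationContinuityZ3.Theorems

open MeasureTheory Literature.Probability.LatticeModels Literature.Probability.Percolation
open scoped Classical BigOperators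

/-- TTRL-lite variant V2096 of `stub_goodStep` (stmt-CriticalPhenomena-4576): the inductive step of
the good-quadruple inequality on eight vertices with a relay set of at most two elements.  Since
`A.card ≤ 2 ≤ 3`, this is a special case of the proved two-relay good step
`stub_goodStepTwoRelays_k41`; the non-degeneracy and induction hypotheses are discarded. -/
theorem stub_goodStep_var2096 : ∀ (w : Sym2 (Fin 8) → unitInterval) (A : Finset (Fin 8)) (o b : Fin 8), A.card ≤ 2 → b ∈ A → o ∉ A → (∃ y : Fin 8, y ∉ A ∧ y ≠ o ∧ (w s(o, y) : ℝ) ≠ 0) → (∀ w' : Sym2 (Fin 8) → unitInterval, (Finset.univ.filter (fun v : Fin 8 => ∃ u : Fin 8, 0 < (w' s(u, v) : ℝ))).card < (Finset.univ.filter (fun v : Fin 8 => ∃ u : Fin 8, 0 < (w s(u, v) : ℝ))).card → ∀ (A' : Finset (Fin 8)) (o' b' : Fin 8), b' ∈ A' → o' ∉ A' → ∀ (t : ℝ) (sel : Finset (Fin 8) → Fin 8), (∀ W, sel W ∈ A') → (∀ a ∈ A', 1 - t ≤ (prodBernoulli w').real (openConn a b')) → (prodBernoulli w').real ((⋃ a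 ∈ A', openConn o' a) ∩ (openConn o' b')ᶜ) + ∑ W ∈ (Finset.univ : Finset (Finset (Fin 8))).filter (fun W => o' ∈ W ∧ Disjoint W A'), (prodBernoulli w').real {ω : BondConfig (Fin 8) | openCluster ω o' = (W : Set (Fin 8))} * (prodBernoulli w').real (openConnIn ((W : Set (Fin 8))ᶜ) (sel W) b')ᶜ ≤ t) → ∀ (t : ℝ) (sel : Finset (Fin 8) → Fin 8), (∀ W, sel W ∈ A) → (∀ a ∈ A, 1 - t ≤ (prodBernoulli w).real (openConn a b)) → (prodBernoulli w).real ((⋃ a ∈ A, openConn o a) ∩ (openConn o b)ᶜ) + ∑ W ∈ (Finset.univ : Finset (Finset (Fin 8))).filter (fun W => o ∈ W ∧ Disjoint W A), (prodBernoulli w).real {ω : BondConfig (Fin 8) | openCluster ω o = (W : Set (Fin 8))} * (prodBernoulli w).real (openConnIn ((W : Set (Fin 8))ᶜ) (sel W) b)ᶜ ≤ t := by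
  intro w A o b hcard hbA hoA _hy _hIH t sel hsel hlev
  exact stub_goodStepTwoRelays_k41 8 w A o b hbA hoA (le_trans hcard (by norm_num)) t sel hsel hlev

end Summit.CriticalPhenomena.PercolationContinuityZ3.Theorems
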